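import Mathlib
import Summits.ResolutionOfSingularities.ResolutionOfSingularities.Theorems.HomologicalConductorPersistenceAuslanderAddCover
import HarnessLib

/-!
# Rung S-2 `PersistenceSurface` (stmt-19970), stub C1 (`Sat₄`) — the two-decomposition certificate BY SUMMANDS:
# finite families of syzygies and of retracts, and `ca(T) = caⁿ⁺² (T) = ⋂_t s̲ann(M_{ψ t})` from per-summand data
# (chain W4.4b, seat res-L1-w44b-stub-4 gen 6; T-V package part 17)

[OURS · L1 w44b · rung S-2] Nothing here is a statement of the manuscript under review (Hironaka 2017);
AI-written, weaker than expert review.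

Part 15 (`…PersistenceAuslanderAddCover`) turned two `add`-decompositions — `Ω V ∈ add (D ⊕ T)` and
`D ∈ add (Ω D ⊕ T)` — into `ca(T) = caⁿ⁺²(T) = s̲ann(D)`.  The data the chain actually has (res-L1-w44b-idea-1
SC-TORIC v2 §2(e)) are PER SUMMAND: the Auslander module splits, `V ≅ ⊕_a M_a` (isotypic pieces), each piece has an
explicit first syzygy `K_a = Ω M_a` decomposing into pieces `M_{ψ t}` from a distinguished sub-family `ψ : κ → ι`
(the duals of the specials, `M_{n−i_t}`; greedy formula (4)), and every distinguished piece `M_{ψ t}` is a direct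
summand of some `K_{ψ s}` (block lemma (5)).  This file is the bookkeeping that assembles such per-summand data
into the hypotheses of part 15, over any commutative ring:

* § Families — `IsSyzygy.piFin` / `IsSyzygy.piFamily`: first syzygies of a finite family give a first syzygy of
  the product `Π a, M a`; `IsRetractOfPower.piFin` / `IsRetractOfPower.piFamily`: `add G` is closed under finite
  products; `isRetractOfPower_eval`: each factor `X i` is a retract of `Π i, X i`;
  `isRetractOfPower_pi_of_forall_exists_retract`: if every `X t` is a retract of some `Y (s t)` then
  `Π t, X t ∈ add (Π s, Y s)`.
* § The certificate by summands — **`cohomologyAnnihilator_eq_of_summandData`** /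
  **`mem_cohomologyAnnihilator_iff_forall_stablyAnnihilates_of_summandData`**: `T` noetherian, `Ωⁿ(mod T) ⊆ add V`,
  `V ≅ Π a, M a`, first syzygies `K a` of `M a` with `K a ∈ add ((Π t, M (ψ t)) ⊕ T)`, and for every `t` a retract
  `M (ψ t) ↪ K (ψ (s t)) ↠ M (ψ t)` ⟹ **`ca(T) = caⁿ⁺²(T)` and `x ∈ ca(T) ↔ ∀ t, x ∈ s̲ann(M (ψ t))`**
  (levelled forms included).  With `n = 2`, `T = U = k[u,v]^{μ_n(1,q)}`, `V = k[u,v]|_U` (part 16's Herzog cover)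
  this is `ca(U) = ca⁴(U) = ⋂_t s̲ann(M_{n−i_t})` from exactly idea-1's data (4) + (5).

References: Iyengar–Takahashi, IMRN 2016, arXiv:1404.1476, §2 [`IyengarTakahashi2014`] (vocabulary); folklore.
-/

-- single-problem summit: the doubled namespace component `ResolutionOfSingularities` is forced
set_option linter.dupNamespace false

noncomputable section

open CategoryTheory Literature.RingTheory.CohomologyAnnihilator
open Summit.ResolutionOfSingularities.ResolutionOfSingularities.Theorems.NoZeno.SandwichCluster
open Summit.ResolutionOfSingularities.ResolutionOfSingularities.Theorems.HomologicalConductor.PersistenceSurfaceHullCover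
open Summit.ResolutionOfSingularities.ResolutionOfSingularities.Theorems.HomologicalConductor.PersistenceSurfaceFiniteCover
open Summit.ResolutionOfSingularities.ResolutionOfSingularities.Theorems.HomologicalConductor.PersistenceSurfaceStepGenerator
open Summit.ResolutionOfSingularities.ResolutionOfSingularities.Theorems.HomologicalConductor.PersistenceAuslanderAddCover

universe u

namespace Summit.ResolutionOfSingularities.ResolutionOfSingularities.Theorems.HomologicalConductor.PersistenceAddCoverFamily

variable {T : Type u} [CommRing T]

/-! ## Finite families of first syzygies -/

/-- First syzygies of a `Fin m`-indexed family give a first syzygy of the product. [folklore] -/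
theorem IsSyzygy.piFin : ∀ (m : ℕ) (M K : Fin m → ModuleCat.{u} T), (∀ i, IsSyzygy 1 (M i) (K i)) →
    IsSyzygy 1 (ModuleCat.of T (Π i, M i)) (ModuleCat.of T (Π i, K i))
  | 0, _, _, _ => isSyzygy_one_of_isZero (ModuleCat.isZero_of_subsingleton _) (ModuleCat.isZero_of_subsingleton _)
  | m + 1, M, K, h =>
    (((h 0).prod (IsSyzygy.piFin m (fun i => M i.succ) (fun i => K i.succ) fun i => h i.succ)).of_iso
      (Fin.consLinearEquiv T (fun i : Fin (m + 1) => (K i : Type u))).toModuleIso).of_iso_base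
      (Fin.consLinearEquiv T (fun i : Fin (m + 1) => (M i : Type u))).toModuleIso

/-- **First syzygies of a finite family give a first syzygy of the product `Π a, M a`.** [folklore] -/
theorem IsSyzygy.piFamily {ι : Type} [Fintype ι] (M K : ι → ModuleCat.{u} T) (h : ∀ a, IsSyzygy 1 (M a) (K a)) :
    IsSyzygy 1 (ModuleCat.of T (Π a, M a)) (ModuleCat.of T (Π a, K a)) := by
  classical
  let e := Fintype.equivFin ι
  have h' := IsSyzygy.piFin (Fintype.card ι) (fun i => M (e.symm i)) (fun i => K (e.symm i)) fun i => h _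
  exact (h'.of_iso (LinearEquiv.piCongrLeft' T (fun a => (K a : Type u)) e).symm.toModuleIso).of_iso_base
    (LinearEquiv.piCongrLeft' T (fun a => (M a : Type u)) e).symm.toModuleIso

/-! ## Finite families in `add G` -/

/-- `add G` is closed under `Fin m`-indexed products. [folklore] -/
theorem IsRetractOfPower.piFin {G : ModuleCat.{u} T} : ∀ (m : ℕ) (X : Fin m → ModuleCat.{u} T),
    (∀ i, IsRetractOfPower G (X i)) → IsRetractOfPower G (ModuleCat.of T (Π i, X i))
  | 0, _, _ => isRetractOfPower_of_isZero G (ModuleCat.isZero_of_subsingleton _)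
  | m + 1, X, h =>
    ((h 0).prod (IsRetractOfPower.piFin m (fun i => X i.succ) fun i => h i.succ)).of_iso
      (Fin.consLinearEquiv T (fun i : Fin (m + 1) => (X i : Type u))).toModuleIso

/-- **`add G` is closed under finite products `Π a, X a`.** [folklore] -/
theorem IsRetractOfPower.piFamily {G : ModuleCat.{u} T} {ι : Type} [Fintype ι] (X : ι → ModuleCat.{u} T)
    (h : ∀ a, IsRetractOfPower G (X a)) : IsRetractOfPower G (ModuleCat.of T (Π a, X a)) := by
  classical
  let e := Fintype.equivFin ι
  exact (IsRetractOfPower.piFin (Fintype.card ι) (fun i => X (e.symm i)) fun i => h _).of_iso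
    (LinearEquiv.piCongrLeft' T (fun a => (X a : Type u)) e).symm.toModuleIso

/-- Each factor `X i` is a retract of the product `Π i, X i` (`single i`, `proj i`). [folklore] -/
theorem isRetractOfPower_eval {ι : Type} [Fintype ι] [DecidableEq ι] (X : ι → ModuleCat.{u} T) (i : ι) :
    IsRetractOfPower (ModuleCat.of T (Π a, X a)) (X i) :=
  (isRetractOfPower_self _).of_retract (ModuleCat.ofHom (LinearMap.single T (fun a => (X a : Type u)) i))
    (ModuleCat.ofHom (LinearMap.proj i)) (by
      apply ModuleCat.hom_ext
      exact LinearMap.ext fun x => by simp)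

/-- **If every `X t` is a retract of some `Y (s t)`, then `Π t, X t ∈ add (Π s, Y s)`.** [folklore] -/
theorem isRetractOfPower_pi_of_forall_exists_retract {ι κ : Type} [Fintype ι] [Fintype κ] [DecidableEq ι]
    (Y : ι → ModuleCat.{u} T) (X : κ → ModuleCat.{u} T)
    (h : ∀ t, ∃ (s : ι) (i : X t ⟶ Y s) (r : Y s ⟶ X t), i ≫ r = 𝟙 (X t)) :
    IsRetractOfPower (ModuleCat.of T (Π s, Y s)) (ModuleCat.of T (Π t, X t)) := by
  refine IsRetractOfPower.piFamily X fun t => ?_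
  obtain ⟨s, i, r, hir⟩ := h t
  exact (isRetractOfPower_eval Y s).of_retract i r hir

/-! ## The certificate by summands -/

section Certificate

variable {ι κ : Type} [Fintype ι] [Fintype κ]

/-- From per-summand data to part 15's two decompositions: `K := Π a, K a` is a first syzygy of `V ≅ Π a, M a`
lying in `add (D ⊕ T)` for `D := Π t, M (ψ t)`, and `D ∈ add (K_D ⊕ T)` for the first syzygy `K_D := Π t, K (ψ t)`
of `D`. [folklore] -/
theorem exists_twoDecompositions_of_summandData {V : ModuleCat.{u} T} (M K : ι → ModuleCat.{u} T)
    (e : V ≅ ModuleCat.of T (Π a, M a)) (hK : ∀ a, IsSyzygy 1 (M a) (K a)) (ψ : κ → ι)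
    (hKD : ∀ a, IsRetractOfPower (ModuleCat.of T ((Π t, M (ψ t)) × T)) (K a))
    (hD : ∀ t, ∃ (s : κ) (i : M (ψ t) ⟶ K (ψ s)) (r : K (ψ s) ⟶ M (ψ t)), i ≫ r = 𝟙 (M (ψ t))) :
    IsSyzygy 1 V (ModuleCat.of T (Π a, K a)) ∧
      IsRetractOfPower (ModuleCat.of T ((ModuleCat.of T (Π t, M (ψ t))) × T)) (ModuleCat.of T (Π a, K a)) ∧
      IsSyzygy 1 (ModuleCat.of T (Π t, M (ψ t))) (ModuleCat.of T (Π t, K (ψ t))) ∧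
      IsRetractOfPower (ModuleCat.of T ((ModuleCat.of T (Π t, K (ψ t))) × T)) (ModuleCat.of T (Π t, M (ψ t))) := by
  classical
  refine ⟨(IsSyzygy.piFamily M K hK).of_iso_base e.symm, IsRetractOfPower.piFamily K hKD,
    IsSyzygy.piFamily (fun t => M (ψ t)) (fun t => K (ψ t)) fun t => hK (ψ t), ?_⟩
  exact (isRetractOfPower_prod_left (ModuleCat.of T (Π t, K (ψ t)))).of_isRetractOfPower_gen
    (isRetractOfPower_pi_of_forall_exists_retract (fun s => K (ψ s)) (fun t => M (ψ t)) hD)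

/-- **`ca(T) = caⁿ⁺²(T)` FROM PER-SUMMAND DATA.**  `T` noetherian; `Ωⁿ(mod T) ⊆ add V`; `V ≅ Π a, M a`; first
syzygies `K a` of the summands with `K a ∈ add ((Π t, M (ψ t)) ⊕ T)` (the summands of every `Ω M_a` are
distinguished pieces or free); every distinguished piece `M (ψ t)` a retract of some `K (ψ s)` (Ω-stability of the
distinguished family up to free summands); distinguished pieces finitely generated.  Then `ca(T) = caⁿ⁺²(T)`.
[OURS · L1 w44b] -/
theorem cohomologyAnnihilator_eq_of_summandData [IsNoetherianRing T] {V : ModuleCat.{u} T} (n : ℕ)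
    (hcov : ∀ (N L : ModuleCat.{u} T), Module.Finite T N → IsSyzygy n N L → IsRetractOfPower V L)
    (M K : ι → ModuleCat.{u} T) (e : V ≅ ModuleCat.of T (Π a, M a)) (hK : ∀ a, IsSyzygy 1 (M a) (K a))
    (ψ : κ → ι) [∀ t, Module.Finite T (M (ψ t))]
    (hKD : ∀ a, IsRetractOfPower (ModuleCat.of T ((Π t, M (ψ t)) × T)) (K a))
    (hD : ∀ t, ∃ (s : κ) (i : M (ψ t) ⟶ K (ψ s)) (r : K (ψ s) ⟶ M (ψ t)), i ≫ r = 𝟙 (M (ψ t))) :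
    cohomologyAnnihilator T = cohomologyAnnihilatorOfDegree T (n + 2) := by
  obtain ⟨h1, h2, h3, h4⟩ := exists_twoDecompositions_of_summandData M K e hK ψ hKD hD
  haveI : Module.Finite T (ModuleCat.of T (Π t, M (ψ t))) :=
    inferInstanceAs (Module.Finite T (Π t, M (ψ t)))
  exact cohomologyAnnihilator_eq_of_cover_of_omegaStable n hcov h1 h2 h3 h4

/-- Levelled form: `caᵐ(T) = caⁿ⁺²(T)` for every `m ≥ n + 2`. [OURS · L1 w44b] -/
theorem cohomologyAnnihilatorOfDegree_eq_of_summandData [IsNoetherianRing T] {V : ModuleCat.{u} T} (n : ℕ)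
    (hcov : ∀ (N L : ModuleCat.{u} T), Module.Finite T N → IsSyzygy n N L → IsRetractOfPower V L)
    (M K : ι → ModuleCat.{u} T) (e : V ≅ ModuleCat.of T (Π a, M a)) (hK : ∀ a, IsSyzygy 1 (M a) (K a))
    (ψ : κ → ι) [∀ t, Module.Finite T (M (ψ t))]
    (hKD : ∀ a, IsRetractOfPower (ModuleCat.of T ((Π t, M (ψ t)) × T)) (K a))
    (hD : ∀ t, ∃ (s : κ) (i : M (ψ t) ⟶ K (ψ s)) (r : K (ψ s) ⟶ M (ψ t)), i ≫ r = 𝟙 (M (ψ t)))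
    {m : ℕ} (hm : n + 2 ≤ m) :
    cohomologyAnnihilatorOfDegree T m = cohomologyAnnihilatorOfDegree T (n + 2) := by
  obtain ⟨h1, h2, h3, h4⟩ := exists_twoDecompositions_of_summandData M K e hK ψ hKD hD
  haveI : Module.Finite T (ModuleCat.of T (Π t, M (ψ t))) :=
    inferInstanceAs (Module.Finite T (Π t, M (ψ t)))
  exact cohomologyAnnihilatorOfDegree_eq_of_cover_of_omegaStable n hcov h1 h2 h3 h4 hm

omit [Fintype ι] in
/-- `x` stably annihilates a finite product iff it stably annihilates every factor. [folklore] -/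
theorem stablyAnnihilates_pi_iff {x : T} (X : κ → ModuleCat.{u} T) :
    StablyAnnihilates T x (ModuleCat.of T (Π t, X t)) ↔ ∀ t, StablyAnnihilates T x (X t) := by
  classical
  constructor
  · intro h t
    exact stablyAnnihilates_of_isRetractOfPower h (isRetractOfPower_eval X t)
  · intro h
    exact StablyAnnihilates.pi (fun t => (X t : Type u)) h

/-- **THE EXACT CENTRE FROM PER-SUMMAND DATA: `x ∈ ca(T) ↔ ∀ t, x ∈ s̲ann(M (ψ t))`** — for rank-one pieces over a
domain this reads `ca(T) = ⋂_t M_{ψ t}·M_{ψ t}⁻¹` (tree `RecurrenceTraceCeiling.stablyAnnihilates_ideal_iff_mem_mul_inv`).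
[OURS · L1 w44b] -/
theorem mem_cohomologyAnnihilator_iff_forall_stablyAnnihilates_of_summandData [IsNoetherianRing T] {V : ModuleCat.{u} T} (n : ℕ)
    (hcov : ∀ (N L : ModuleCat.{u} T), Module.Finite T N → IsSyzygy n N L → IsRetractOfPower V L)
    (M K : ι → ModuleCat.{u} T) (e : V ≅ ModuleCat.of T (Π a, M a)) (hK : ∀ a, IsSyzygy 1 (M a) (K a))
    (ψ : κ → ι) [∀ t, Module.Finite T (M (ψ t))]
    (hKD : ∀ a, IsRetractOfPower (ModuleCat.of T ((Π t, M (ψ t)) × T)) (K a))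
    (hD : ∀ t, ∃ (s : κ) (i : M (ψ t) ⟶ K (ψ s)) (r : K (ψ s) ⟶ M (ψ t)), i ≫ r = 𝟙 (M (ψ t))) (x : T) :
    x ∈ cohomologyAnnihilator T ↔ ∀ t, StablyAnnihilates T x (M (ψ t)) := by
  obtain ⟨h1, h2, h3, h4⟩ := exists_twoDecompositions_of_summandData M K e hK ψ hKD hD
  haveI : Module.Finite T (ModuleCat.of T (Π t, M (ψ t))) :=
    inferInstanceAs (Module.Finite T (Π t, M (ψ t)))
  rw [mem_cohomologyAnnihilator_iff_stablyAnnihilates_of_cover_of_omegaStable n hcov h1 h2 h3 h4 x]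
  exact stablyAnnihilates_pi_iff (fun t => M (ψ t))

/-- Levelled exact centre: `x ∈ caⁿ⁺²(T) ↔ ∀ t, x ∈ s̲ann(M (ψ t))`. [OURS · L1 w44b] -/
theorem mem_cohomologyAnnihilatorOfDegree_iff_forall_stablyAnnihilates_of_summandData [IsNoetherianRing T] {V : ModuleCat.{u} T}
    (n : ℕ) (hcov : ∀ (N L : ModuleCat.{u} T), Module.Finite T N → IsSyzygy n N L → IsRetractOfPower V L)
    (M K : ι → ModuleCat.{u} T) (e : V ≅ ModuleCat.of T (Π a, M a)) (hK : ∀ a, IsSyzygy 1 (M a) (K a))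
    (ψ : κ → ι) [∀ t, Module.Finite T (M (ψ t))]
    (hKD : ∀ a, IsRetractOfPower (ModuleCat.of T ((Π t, M (ψ t)) × T)) (K a))
    (hD : ∀ t, ∃ (s : κ) (i : M (ψ t) ⟶ K (ψ s)) (r : K (ψ s) ⟶ M (ψ t)), i ≫ r = 𝟙 (M (ψ t))) (x : T) :
    x ∈ cohomologyAnnihilatorOfDegree T (n + 2) ↔ ∀ t, StablyAnnihilates T x (M (ψ t)) := by
  rw [← cohomologyAnnihilator_eq_of_summandData n hcov M K e hK ψ hKD hD]
  exact mem_cohomologyAnnihilator_iff_forall_stablyAnnihilates_of_summandData n hcov M K e hK ψ hKD hD x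

end Certificate

end Summit.ResolutionOfSingularities.ResolutionOfSingularities.Theorems.HomologicalConductor.PersistenceAddCoverFamily

end
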